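import Mathlib
import HarnessLib

/-!
# Gauss rules by eigenvalue methods: Golub–Welsch (Davis–Rabinowitz 1984, Sect. 2.7.5)

Davis–Rabinowitz, *Methods of Numerical Integration* (2nd ed., 1984), Sect. 2.7.5 "Computation of Gauss Rules by
Eigenvalue Methods", (2.7.5.5)–(2.7.5.12) (Golub and Welsch).

Real orthonormal polynomials `p₀*, …, p_N*` satisfy the symmetric three-term recurrence
`x p*_{n-1}(x) = α_n p*_n(x) + β_n p*_{n-1}(x) + α_{n-1} p*_{n-2}(x)` (2.7.5.5) (`α_n = k_{n-1}/k_n`,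
`β_n = -b_n/a_n`).  With `P(x) = [p₀*(x), …, p*_{N-1}(x)]ᵀ`, `E = [0, …, 0, 1]ᵀ` and the symmetric tridiagonal
JACOBI MATRIX `J` (2.7.5.6) (diagonal `β_1, …, β_N`, off-diagonals `α_1, …, α_{N-1}`), the recurrence reads
`x P(x) = J P(x) + α_N p*_N(x) E` (2.7.5.7); hence `x_i` is a zero of `p*_N` iff `x_i P(x_i) = J P(x_i)` (2.7.5.8):
the Gauss abscissas are the eigenvalues of `J` and `P(x_i)` the eigenvectors.  From `1/w_j = Σ_{n<N} (p*_n(x_j))²`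
(2.7.5.9)–(2.7.5.10), `Q(x_j) = w_j^{1/2} P(x_j)` (2.7.5.11) is the normalised eigenvector and, `p₀*` being the
constant `m₀^{-1/2}`, `w_j = m₀ q_{0j}²` (2.7.5.12).

This file records, over a commutative ring:
* `jacobiTridiag α β N` (2.7.5.6), its symmetry and its row action (`jacobiTridiag_mulVec`);
* (2.7.5.7) `IsSymmRecurrence.jacobiTridiag_mulVec_add` for any polynomial sequence satisfying (2.7.5.5)
  (`IsSymmRecurrence`, hypothesis form: `n = 1` with `p*_{-1} = 0`, and `n = 2, …, N`);
* (2.7.5.8) both directions: a zero of `p*_N` gives the eigenvector equation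
  (`IsSymmRecurrence.mulVec_eq_smul_of_isRoot`, with `P(x₀) ≠ 0` as soon as `p₀*` is a non-zero constant,
  `evalVec_ne_zero`), and the eigenvector equation forces `p*_N(x₀) = 0` when `α_N ≠ 0`
  (`IsSymmRecurrence.isRoot_of_mulVec_eq_smul`);
* (2.7.5.10)–(2.7.5.12) over `ℝ`: the normalisation of `w_j^{1/2} P(x_j)` and `w_j = m₀ q_{0j}²`
  (`sum_sq_sqrt_mul_eq_one`, `weight_eq_m0_mul_sq`), and the same weight read off an UNnormalised eigenvector,
  `gwWeight m₀ v = m₀ v₀² / Σ v_k²` (`gwWeight_eq_of_normalised`);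
* the method run by hand on the two smallest Gauss–Legendre cases (`w ≡ 1` on `[-1, 1]`, `m₀ = 2`, `β_n = 0`,
  `α_1² = 1/3`, `α_2² = 4/15`): `J₂` has eigenpairs `(±a, (1, ±1))`, weights `2 · ½ = 1, 1`; `J₃` has eigenpairs
  `(0, (α_2, 0, -α_1))` and `(±v, (α_1, ±v, α_2))` with `v² = α_1² + α_2² = 3/5`, and (2.7.5.12) returns the weights
  `8/9` and `5/9, 5/9` — the rules `G₂`, `G₃` of the tree's `GaussFamilyLowOrder` (nodes `u² = 1/3`; `0`, `v² = 3/5`),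
  which are not restated.  As there, the irrational entries enter only through their squares.
The Q-R step, the moment matrix (2.7.5.13)–(2.7.5.14) and the representation (2.7.5.9) itself (Szegő) are not
formalised; (2.7.5.9) enters (2.7.5.10)–(2.7.5.12) as a hypothesis.

Provenance: engines group, shared numerical engines serving client cells; rigour lives in the verifiers; every
published number belongs to a client cell's ledger, not to the engines group.  Textbook facts only (no client
numbers).
-/

namespace Literature.Analysis.Quadrature

open Polynomial Finset Matrix

noncomputable section

namespace GolubWelsch

variable {R : Type*} [CommRing R]

/-! ### (2.7.5.6): the Jacobi matrix -/

/-- (2.7.5.6): the symmetric tridiagonal Jacobi matrix `J` of order `N`: diagonal `β_1, …, β_N`, entries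
`α_i` at the (0-based) positions `(i-1, i)` and `(i, i-1)`, `i = 1, …, N-1`.
[cite: DavisRabinowitz1984, Sect. 2.7.5 (2.7.5.6)] -/
def jacobiTridiag (α β : ℕ → R) (N : ℕ) : Matrix (Fin N) (Fin N) R :=
  Matrix.of fun i j => if (j : ℕ) = i + 1 then α (i + 1) else if (i : ℕ) = j then β (i + 1)
    else if (i : ℕ) = j + 1 then α (j + 1) else 0

/-- The entries of (2.7.5.6). [cite: DavisRabinowitz1984, Sect. 2.7.5 (2.7.5.6)] -/
theorem jacobiTridiag_apply (α β : ℕ → R) (N : ℕ) (i j : Fin N) :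
    jacobiTridiag α β N i j = if (j : ℕ) = i + 1 then α (i + 1) else if (i : ℕ) = j then β (i + 1)
      else if (i : ℕ) = j + 1 then α (j + 1) else 0 := rfl

/-- `J` is symmetric. [cite: DavisRabinowitz1984, Sect. 2.7.5 (2.7.5.6)] -/
theorem jacobiTridiag_symm (α β : ℕ → R) (N : ℕ) (i j : Fin N) :
    jacobiTridiag α β N i j = jacobiTridiag α β N j i := by
  simp only [jacobiTridiag_apply]
  split_ifs <;> first | rfl | omega | (congr 1; omega)

/-- `Jᵀ = J`. [cite: DavisRabinowitz1984, Sect. 2.7.5 (2.7.5.6)] -/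
theorem jacobiTridiag_transpose (α β : ℕ → R) (N : ℕ) : (jacobiTridiag α β N)ᵀ = jacobiTridiag α β N := by
  ext i j
  rw [transpose_apply, jacobiTridiag_symm]

/-- The row action of `J`: `(J v)_i = β_{i+1} v_i + α_{i+1} v_{i+1} + α_i v_{i-1}` (0-based `i`; the terms falling
outside `0, …, N-1` are absent). [cite: DavisRabinowitz1984, Sect. 2.7.5 (2.7.5.6)] -/
theorem jacobiTridiag_mulVec (α β : ℕ → R) {N : ℕ} (v : Fin N → R) (i : Fin N) :
    (jacobiTridiag α β N).mulVec v i =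
      β (i + 1) * v i + (if h : (i : ℕ) + 1 < N then α (i + 1) * v ⟨i + 1, h⟩ else 0) +
        (if 0 < (i : ℕ) then α i * v ⟨i - 1, lt_of_le_of_lt (Nat.sub_le _ _) i.isLt⟩ else 0) := by
  simp only [Matrix.mulVec, dotProduct, jacobiTridiag_apply]
  have hsplit : ∀ j : Fin N, (if (j : ℕ) = i + 1 then α (i + 1) else if (i : ℕ) = j then β (i + 1)
      else if (i : ℕ) = j + 1 then α (j + 1) else 0) * v j =
      (if i = j then β (i + 1) * v j else 0) + (if (j : ℕ) = i + 1 then α (i + 1) * v j else 0) +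
        (if (i : ℕ) = j + 1 then α (j + 1) * v j else 0) := by
    intro j
    by_cases h1 : (j : ℕ) = i + 1
    · have h2 : i ≠ j := fun h => by rw [h] at h1; omega
      have h3 : ¬ ((i : ℕ) = j + 1) := by omega
      rw [if_pos h1, if_neg h2, if_pos h1, if_neg h3, zero_add, add_zero]
    · by_cases h2 : i = j
      · subst h2
        rw [if_neg h1, if_pos rfl, if_pos rfl, if_neg h1, add_zero, add_zero]
      · have h2' : (i : ℕ) ≠ j := fun h => h2 (Fin.ext h)
        by_cases h3 : (i : ℕ) = j + 1
        · rw [if_neg h1, if_neg h2', if_pos h3, if_neg h2, if_neg h1, if_pos h3, zero_add, zero_add]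
        · rw [if_neg h1, if_neg h2', if_neg h3, if_neg h2, if_neg h1, if_neg h3, zero_mul, add_zero, add_zero]
  have hup : ∑ j : Fin N, (if (j : ℕ) = i + 1 then α (i + 1) * v j else 0) =
      if h : (i : ℕ) + 1 < N then α (i + 1) * v ⟨i + 1, h⟩ else 0 := by
    by_cases h : (i : ℕ) + 1 < N
    · rw [dif_pos h]
      have hc : ∀ j : Fin N, ((j : ℕ) = i + 1) = ((⟨i + 1, h⟩ : Fin N) = j) := fun j =>
        propext ⟨fun hj => Fin.ext hj.symm, fun hj => by rw [← hj]⟩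
      simp_rw [hc]
      rw [Finset.sum_ite_eq, if_pos (Finset.mem_univ _)]
    · rw [dif_neg h]
      exact Finset.sum_eq_zero fun j _ => if_neg (by have := j.isLt; omega)
  have hlow : ∑ j : Fin N, (if (i : ℕ) = j + 1 then α (j + 1) * v j else 0) =
      if 0 < (i : ℕ) then α i * v ⟨i - 1, lt_of_le_of_lt (Nat.sub_le _ _) i.isLt⟩ else 0 := by
    by_cases h : 0 < (i : ℕ)
    · rw [if_pos h]
      have hc : ∀ j : Fin N, ((i : ℕ) = j + 1) =
          ((⟨i - 1, lt_of_le_of_lt (Nat.sub_le _ _) i.isLt⟩ : Fin N) = j) := fun j =>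
        propext ⟨fun hj => Fin.ext (by show (i : ℕ) - 1 = j; omega),
          fun hj => by rw [← hj]; show (i : ℕ) = (i : ℕ) - 1 + 1; omega⟩
      simp_rw [hc]
      rw [Finset.sum_ite_eq, if_pos (Finset.mem_univ _)]
      have e : (i : ℕ) - 1 + 1 = i := Nat.sub_add_cancel h
      simp only [e]
    · rw [if_neg h]
      exact Finset.sum_eq_zero fun j _ => if_neg (by omega)
  rw [Finset.sum_congr rfl fun j _ => hsplit j, Finset.sum_add_distrib, Finset.sum_add_distrib,
    Finset.sum_ite_eq Finset.univ i, if_pos (Finset.mem_univ _), hup, hlow]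

/-! ### (2.7.5.5), (2.7.5.7), (2.7.5.8) -/

/-- (2.7.5.5), hypothesis form: the polynomials `p 0, p 1, …` satisfy the symmetric three-term recurrence
`x p_{n-1} = α_n p_n + β_n p_{n-1} + α_{n-1} p_{n-2}` for `n = 1` (with `p_{-1} = 0`) and `n = 2, …, N`
(0-based: `k = n - 1`). [cite: DavisRabinowitz1984, Sect. 2.7.5 (2.7.5.5)] -/
structure IsSymmRecurrence (α β : ℕ → R) (p : ℕ → R[X]) (N : ℕ) : Prop where
  zero : 0 < N → X * p 0 = C (α 1) * p 1 + C (β 1) * p 0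
  succ : ∀ k, k + 2 ≤ N →
    X * p (k + 1) = C (α (k + 2)) * p (k + 2) + C (β (k + 2)) * p (k + 1) + C (α (k + 1)) * p k

/-- (2.7.5.7), componentwise: `x P(x) = J P(x) + α_N p_N(x) E`, `P(x) = [p_0(x), …, p_{N-1}(x)]ᵀ`,
`E = [0, …, 0, 1]ᵀ`. [cite: DavisRabinowitz1984, Sect. 2.7.5 (2.7.5.7)] -/
theorem IsSymmRecurrence.jacobiTridiag_mulVec_add {α β : ℕ → R} {p : ℕ → R[X]} {N : ℕ}
    (h : IsSymmRecurrence α β p N) (x : R) (i : Fin N) :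
    (jacobiTridiag α β N).mulVec (fun j => (p j).eval x) i +
        (if (i : ℕ) + 1 = N then α N * (p N).eval x else 0) = x * (p i).eval x := by
  rw [jacobiTridiag_mulVec]
  obtain ⟨n, hn⟩ := i
  cases n with
  | zero =>
    have e := congrArg (eval x) (h.zero hn)
    simp only [eval_mul, eval_X, eval_add, eval_C] at e
    simp only [zero_add]
    split_ifs <;> first | omega | linear_combination -e | (subst_vars; linear_combination -e)
  | succ k =>
    have e := congrArg (eval x) (h.succ k (by omega))
    rw [show k + 2 = k + 1 + 1 from rfl] at e
    simp only [eval_mul, eval_X, eval_add, eval_C] at e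
    simp only [Nat.add_sub_cancel]
    split_ifs <;> first | omega | linear_combination -e | (subst_vars; linear_combination -e)

/-- (2.7.5.8), "if": a zero `x₀` of `p_N` is an eigenvalue of `J` with eigenvector `P(x₀)`:
`J P(x₀) = x₀ P(x₀)`. [cite: DavisRabinowitz1984, Sect. 2.7.5 (2.7.5.8)] -/
theorem IsSymmRecurrence.mulVec_eq_smul_of_isRoot {α β : ℕ → R} {p : ℕ → R[X]} {N : ℕ}
    (h : IsSymmRecurrence α β p N) {x₀ : R} (hx : (p N).IsRoot x₀) :
    (jacobiTridiag α β N).mulVec (fun j : Fin N => (p j).eval x₀) = x₀ • fun j : Fin N => (p j).eval x₀ := by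
  funext i
  have e := h.jacobiTridiag_mulVec_add x₀ i
  rw [show (p N).eval x₀ = 0 from hx, mul_zero, ite_self, add_zero] at e
  rw [e, Pi.smul_apply, smul_eq_mul]

/-- The eigenvector `P(x₀)` is non-zero as soon as `p_0` is a non-zero constant (for orthonormal polynomials
`p_0* = m_0^{-1/2}`). [cite: DavisRabinowitz1984, Sect. 2.7.5 (2.7.5.8)] -/
theorem evalVec_ne_zero {p : ℕ → R[X]} {N : ℕ} (hN : 0 < N) {c : R} (hc : c ≠ 0) (hp0 : p 0 = C c) (x₀ : R) :
    (fun j : Fin N => (p j).eval x₀) ≠ 0 := by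
  intro h0
  have e := congrFun h0 ⟨0, hN⟩
  simp only [hp0, eval_C, Pi.zero_apply] at e
  exact hc e

/-- (2.7.5.8), "only if": if `J P(x₀) = x₀ P(x₀)` and `α_N ≠ 0` (no zero divisors), then `p_N(x₀) = 0` — read off
the last component of (2.7.5.7). [cite: DavisRabinowitz1984, Sect. 2.7.5 (2.7.5.8)] -/
theorem IsSymmRecurrence.isRoot_of_mulVec_eq_smul [NoZeroDivisors R] {α β : ℕ → R} {p : ℕ → R[X]} {N : ℕ}
    (h : IsSymmRecurrence α β p N) (hN : 0 < N) (hα : α N ≠ 0) {x₀ : R}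
    (hx : (jacobiTridiag α β N).mulVec (fun j : Fin N => (p j).eval x₀) = x₀ • fun j : Fin N => (p j).eval x₀) :
    (p N).IsRoot x₀ := by
  have e := h.jacobiTridiag_mulVec_add x₀ ⟨N - 1, by omega⟩
  have hc : ((⟨N - 1, by omega⟩ : Fin N) : ℕ) + 1 = N := by
    show N - 1 + 1 = N
    omega
  rw [if_pos hc, congrFun hx ⟨N - 1, by omega⟩, Pi.smul_apply, smul_eq_mul] at e
  have h0 : α N * (p N).eval x₀ = 0 := by linear_combination e
  exact (mul_eq_zero.mp h0).resolve_left hα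

/-! ### (2.7.5.9)–(2.7.5.12): the weights from the first components -/

/-- (2.7.5.10)–(2.7.5.11): if `w_j Σ_{n<N} p_n(x_j)² = 1` then `Q(x_j) = w_j^{1/2} P(x_j)` is a unit vector.
[cite: DavisRabinowitz1984, Sect. 2.7.5 (2.7.5.11)] -/
theorem sum_sq_sqrt_mul_eq_one {N : ℕ} {w : ℝ} (hw : 0 ≤ w) (P : Fin N → ℝ)
    (h : w * ∑ n, P n ^ 2 = 1) : ∑ n, (Real.sqrt w * P n) ^ 2 = 1 := by
  simp_rw [mul_pow, Real.sq_sqrt hw, ← Finset.mul_sum]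
  exact h

/-- (2.7.5.12): with `q_{0j} = w_j^{1/2} p_0*(x_j)` and `p_0* ≡ m_0^{-1/2}` (`m_0 = ∫_a^b w`), `w_j = m_0 q_{0j}²`.
[cite: DavisRabinowitz1984, Sect. 2.7.5 (2.7.5.12)] -/
theorem weight_eq_m0_mul_sq {w m₀ p₀ : ℝ} (hw : 0 ≤ w) (hm : 0 < m₀) (hp : p₀ = 1 / Real.sqrt m₀) :
    w = m₀ * (Real.sqrt w * p₀) ^ 2 := by
  rw [hp, mul_pow, Real.sq_sqrt hw, div_pow, one_pow, Real.sq_sqrt hm.le]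
  field_simp

/-- (2.7.5.12) read off an UNnormalised eigenvector `v` of `J`: normalising gives `q_0² = v_0² / Σ v_k²`, so
`w = m_0 v_0² / Σ_k v_k²`. [cite: DavisRabinowitz1984, Sect. 2.7.5 (2.7.5.12)] -/
def gwWeight (m₀ : ℝ) {N : ℕ} [NeZero N] (v : Fin N → ℝ) : ℝ :=
  m₀ * v 0 ^ 2 / ∑ k, v k ^ 2

/-- `gwWeight` is (2.7.5.12) for the normalised vector `q = v / ‖v‖`: `m_0 q_0² = m_0 v_0² / Σ v_k²`.
[cite: DavisRabinowitz1984, Sect. 2.7.5 (2.7.5.12)] -/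
theorem gwWeight_eq_of_normalised (m₀ : ℝ) {N : ℕ} [NeZero N] (v : Fin N → ℝ) (hv : ∑ k, v k ^ 2 ≠ 0) :
    m₀ * (v 0 / Real.sqrt (∑ k, v k ^ 2)) ^ 2 = gwWeight m₀ v := by
  rw [gwWeight, div_pow, Real.sq_sqrt (Finset.sum_nonneg fun k _ => sq_nonneg (v k))]
  field_simp

/-! ### The method on `G₂` and `G₃` (`w ≡ 1` on `[-1, 1]`: `m₀ = 2`, `β_n = 0`, `α_1² = 1/3`, `α_2² = 4/15`) -/

/-- The Jacobi matrix of order `2` for `w ≡ 1` on `[-1, 1]`: `β = 0`, `α_1 = a` (`a² = 1/3`).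
[cite: DavisRabinowitz1984, Sect. 2.7.5 (2.7.5.6)] -/
theorem jacobiTridiag_legendre_two (a : ℝ) :
    jacobiTridiag (fun _ => a) (fun _ => (0 : ℝ)) 2 = !![0, a; a, 0] := by
  ext i j
  fin_cases i <;> fin_cases j <;> simp [jacobiTridiag_apply]

/-- Golub–Welsch on `G₂`: `J₂ = [[0, a], [a, 0]]` (`a² = 1/3`) has the eigenpairs `(a, (1, 1))`, `(-a, (1, -1))` —
nodes `±a`, `a² = 1/3` — and (2.7.5.12) with `m₀ = 2` gives the weights `2 · ½ = 1, 1`: the rule `G₂`.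
[cite: DavisRabinowitz1984, Sect. 2.7.5 (2.7.5.8)] [cite: DavisRabinowitz1984, Sect. 2.7.5 (2.7.5.12)] -/
theorem golubWelsch_gaussLegendre_two (a : ℝ) :
    (!![0, a; a, 0]).mulVec ![1, 1] = a • ![1, 1] ∧ (!![0, a; a, 0]).mulVec ![1, -1] = (-a) • ![1, -1] ∧
      gwWeight 2 ![(1 : ℝ), 1] = 1 ∧ gwWeight 2 ![(1 : ℝ), -1] = 1 := by
  refine ⟨?_, ?_, ?_, ?_⟩
  · ext i; fin_cases i <;> simp [Matrix.mulVec, dotProduct, Fin.sum_univ_two]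
  · ext i; fin_cases i <;> simp [Matrix.mulVec, dotProduct, Fin.sum_univ_two]
  · norm_num [gwWeight, Fin.sum_univ_two]
  · norm_num [gwWeight, Fin.sum_univ_two]

/-- The Jacobi matrix of order `3` for `w ≡ 1` on `[-1, 1]`: `β = 0`, `α_1 = a`, `α_2 = c`
(`a² = 1/3`, `c² = 4/15`). [cite: DavisRabinowitz1984, Sect. 2.7.5 (2.7.5.6)] -/
theorem jacobiTridiag_legendre_three (a c : ℝ) :
    jacobiTridiag (fun n => if n = 1 then a else c) (fun _ => (0 : ℝ)) 3 = !![0, a, 0; a, 0, c; 0, c, 0] := by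
  ext i j
  fin_cases i <;> fin_cases j <;> simp [jacobiTridiag_apply]

/-- Golub–Welsch on `G₃`: for `a² = 1/3`, `c² = 4/15`, `v² = 3/5` (`= a² + c²`), `J₃ = [[0,a,0],[a,0,c],[0,c,0]]` has
the eigenpairs `(0, (c, 0, -a))`, `(v, (a, v, c))`, `(-v, (a, -v, c))` — nodes `0, ±v`, `v² = 3/5` — and (2.7.5.12)
with `m₀ = 2` gives the weights `2c²/(a² + c²) = 8/9` and `2a²/(a² + v² + c²) = 5/9, 5/9`: the rule `G₃`.
[cite: DavisRabinowitz1984, Sect. 2.7.5 (2.7.5.8)] [cite: DavisRabinowitz1984, Sect. 2.7.5 (2.7.5.12)] -/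
theorem golubWelsch_gaussLegendre_three (a c v : ℝ) (ha : a ^ 2 = 1 / 3) (hc : c ^ 2 = 4 / 15)
    (hv : v ^ 2 = 3 / 5) :
    (!![0, a, 0; a, 0, c; 0, c, 0]).mulVec ![c, 0, -a] = (0 : ℝ) • ![c, 0, -a] ∧
      (!![0, a, 0; a, 0, c; 0, c, 0]).mulVec ![a, v, c] = v • ![a, v, c] ∧
      (!![0, a, 0; a, 0, c; 0, c, 0]).mulVec ![a, -v, c] = (-v) • ![a, -v, c] ∧
      gwWeight 2 ![c, 0, -a] = 8 / 9 ∧ gwWeight 2 ![a, v, c] = 5 / 9 ∧ gwWeight 2 ![a, -v, c] = 5 / 9 := by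
  refine ⟨?_, ?_, ?_, ?_, ?_, ?_⟩
  · ext i; fin_cases i <;> simp [Matrix.mulVec, dotProduct, Fin.sum_univ_three]; ring
  · ext i; fin_cases i <;> simp [Matrix.mulVec, dotProduct, Fin.sum_univ_three] <;>
      first | linear_combination ha + hc - hv | ring
  · ext i; fin_cases i <;> simp [Matrix.mulVec, dotProduct, Fin.sum_univ_three] <;>
      first | linear_combination ha + hc - hv | ring
  · have hs : ∑ k : Fin 3, (![c, 0, -a] : Fin 3 → ℝ) k ^ 2 = c ^ 2 + a ^ 2 := by
      simp [Fin.sum_univ_three]; try ring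
    rw [gwWeight, hs, div_eq_iff (by nlinarith), Matrix.cons_val_zero]
    linear_combination (10 / 9 : ℝ) * hc - (8 / 9 : ℝ) * ha
  · have hs : ∑ k : Fin 3, (![a, v, c] : Fin 3 → ℝ) k ^ 2 = a ^ 2 + v ^ 2 + c ^ 2 := by
      simp [Fin.sum_univ_three]; try ring
    rw [gwWeight, hs, div_eq_iff (by nlinarith), Matrix.cons_val_zero]
    linear_combination (13 / 9 : ℝ) * ha - (5 / 9 : ℝ) * hv - (5 / 9 : ℝ) * hc
  · have hs : ∑ k : Fin 3, (![a, -v, c] : Fin 3 → ℝ) k ^ 2 = a ^ 2 + v ^ 2 + c ^ 2 := by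
      simp [Fin.sum_univ_three]; try ring
    rw [gwWeight, hs, div_eq_iff (by nlinarith), Matrix.cons_val_zero]
    linear_combination (13 / 9 : ℝ) * ha - (5 / 9 : ℝ) * hv - (5 / 9 : ℝ) * hc

/-- The `G₃` eigenvalue relation `v² = α_1² + α_2²`: `1/3 + 4/15 = 3/5`, i.e. `det(xI - J₃) = x³ - (3/5)x`
has the roots `0, ±(3/5)^{1/2}`. [cite: DavisRabinowitz1984, Sect. 2.7.5 (2.7.5.8)] -/
theorem legendre_three_offdiag_sq_sum : (1 : ℝ) / 3 + 4 / 15 = 3 / 5 := by norm_num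

end GolubWelsch

end

end Literature.Analysis.Quadrature
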